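import Mathlib
import HarnessLib
import HarnessLib.Audit
import Summits.CriticalPhenomena.PercolationContinuityZ3.Theorems.PercNearOneGluingNoHeavyLowerTailHexMSMatchTightInsert

/-!
# Conjecture (MATCH), two dead classes: non-full families — tight ones have slack, and the reduction to 'non-full ⟹ slack ≥ 2' (hp-7 gen 70)

Support file for crux `stmt-CriticalPhenomena-4575` (route `PercNearOneGluingNoHeavy`), hull-port seat `prim-hp-7` (generation 70);
`--supports stmt-CriticalPhenomena-4575`.  No `sorry`, no definition.  Memo: `run/shared/lean/prim/prim-hp-7/FROM-prim-hp-7-g70-MS-EQUALITY.md` §0 (FULL).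

A two-class dead family `G` (labels in `{ℓ, ℓ+1}`) is FULL if it contains every dead member of these two labels.  Candidates of `cl G` use
partners from ALL of `𝒟`, so a missing dead member `q` already acts on `N(cl G)`:

* `candidate_shape_of_tight` — the key lemma of `…HexMSMatchAxisInsert` with the explicit SHAPE of the new set (`q \ c`, `c \ q`, or `c ∩ q` with both
  blockers); `sdiff_mem_candidates_four`; hence `exists_candidate_notMem_cl_diffs'` (a candidate of `U \ c` or `c`: inside `N(cl F)`) and
  `exists_candidate_notMem_cl_diffs''` (a candidate of `q` or `U \ q`: inside `N(cl H)` for every family `H ∋ q`);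
* `two_mul_card_add_two_le_card_biUnion_candidates_of_tight_of_extra(')` — **a nonempty MS-tight two-class dead family that is NOT full has
  `#N(cl F) ≥ 2 #F + 2`**, i.e. is not Hall-tight (missing member of either label);
* `card_cl_le_card_biUnion_candidates_of_nonFull` — **if every nonempty non-full two-class dead family `G` has `#cl G + 2 ≤ #N(cl G)`, then
  Hall's condition holds for ALL two-class dead families** (the full family borrows the slack of `F.erase g`).  The hypothesis is the preceding
  theorem for MS-tight `G`; for non-MS-tight `G` ('a Hall-tight non-MS-tight two-class family is full') it is certified exactly for `n ≤ 5` by SAT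
  (gen 70, `code/gen70/kit70c/hardcore.py --mode one`, kit j238583: UNSAT n = 3, 4, 5) and by the exhaustive `n = 4` census — this is now the
  single open statement separating the tree from two-class (MATCH).
-/

namespace Summit.CriticalPhenomena.PercolationContinuityZ3.Theorems

namespace GeneratedDonors

open Finset FinsetFamily

variable {α : Type*} [DecidableEq α]

section NonFull

/-! ### Two dead classes: a NON-FULL MS-tight family has Hall slack ≥ 2, and the reduction of two-class (MATCH) to 'non-full ⟹ slack ≥ 2' -/

variable {U : Finset α} {𝒟 : Finset (Finset α)} {x : Finset α → ZMod 6}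

/-- **The key lemma with explicit shape.**  For an MS-tight two-class dead family `F` (pivot `c`, twisted-product data `htp`, `hsplit`) and a dead
`q ∉ F` with `x q = ℓ + 1`, one of the following holds: `q \ c` is absent and outside `ΔF ∪ co ΔF`; or `c \ q` is; or both are members (blockers) and
`c ∩ q` is absent and outside `ΔF ∪ co ΔF`.  (Same case analysis as `exists_candidate_notMem_cl_diffs` in `…HexMSMatchAxisInsert`, which only recorded
a candidate of `q` or `c`; the shape lets us place the new set in `N(cl H)` for any family `H` containing `c` or containing `q`.) -/
theorem candidate_shape_of_tight (hU : ∀ a ∈ 𝒟, a ⊆ U) (hco : ∀ a ∈ 𝒟, U \ a ∈ 𝒟)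
    (hanti : ∀ a ∈ 𝒟, x (U \ a) = x a + 3) {F : Finset (Finset α)} (hF : F ⊆ dead U 𝒟 x) {ℓ : ZMod 6}
    (hFlab : ∀ f ∈ F, x f = ℓ ∨ x f = ℓ + 1) {q : Finset α} (hq : q ∈ dead U 𝒟 x) (hqlab : x q = ℓ + 1) (hqF : q ∉ F)
    {c : Finset α} (hcF : c ∈ F)
    (htp : ∀ e₁ ∈ F.image (c \ ·), ∀ e₂ ∈ F.image (· \ c), (c \ e₁) ∪ e₂ ∈ F)
    (hsplit : ∀ e ∈ F \\ F, e ∩ c ∈ F.image (c \ ·) ∧ e \ c ∈ F.image (· \ c)) :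
    (q \ c ∉ 𝒟 ∧ q \ c ∉ F \\ F ∧ q \ c ∉ (F \\ F).image (fun z => U \ z)) ∨
    (c \ q ∉ 𝒟 ∧ c \ q ∉ F \\ F ∧ c \ q ∉ (F \\ F).image (fun z => U \ z)) ∨
    (q \ c ∈ 𝒟 ∧ c \ q ∈ 𝒟 ∧ c ∩ q ∉ 𝒟 ∧ c ∩ q ∉ F \\ F ∧ c ∩ q ∉ (F \\ F).image (fun z => U \ z)) := by
  have hFD : ∀ f ∈ F, f ∈ 𝒟 := fun f hf => (mem_filter.mp (hF hf)).1
  have hFdead : ∀ f ∈ F, f ∉ symGen U 𝒟 x := fun f hf => (mem_filter.mp (hF hf)).2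
  have hc : c ∈ dead U 𝒟 x := hF hcF
  have hcD : c ∈ 𝒟 := hFD c hcF
  have hqD : q ∈ 𝒟 := (mem_filter.mp hq).1
  have hqdead : q ∉ symGen U 𝒟 x := (mem_filter.mp hq).2
  have hcU : c ⊆ U := hU c hcD
  have hqU : q ⊆ U := hU q hqD
  have h0E₁ : ∅ ∈ F.image (c \ ·) := mem_image.mpr ⟨c, hcF, Finset.sdiff_self c⟩
  have h0E₂ : ∅ ∈ F.image (· \ c) := mem_image.mpr ⟨c, hcF, Finset.sdiff_self c⟩
  have hncov : ∀ f ∈ F, f ∪ c ≠ U := fun f hf =>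
    union_ne_of_dead_of_close hU hco hanti (hF hf) hcD (close_of_mem_pair (hFlab f hf) (hFlab c hcF))
  -- `q \ c ∉ co ΔF`
  have L3 : q \ c ∉ (F \\ F).image (fun z => U \ z) := by
    intro h
    obtain ⟨e, he, hee⟩ := mem_image.mp h
    obtain ⟨p, hp, hpe⟩ := mem_image.mp (hsplit e he).1
    have hce : e ∩ c = c := by
      ext i; simp only [mem_inter]
      constructor
      · exact fun h => h.2
      · intro hic
        refine ⟨?_, hic⟩
        by_contra hie
        have : i ∈ U \ e := mem_sdiff.mpr ⟨hcU hic, hie⟩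
        rw [hee, mem_sdiff] at this
        exact this.2 hic
    have hcp : (c ∩ p).Nonempty :=
      inter_nonempty_of_dead_of_close hc (hFD p hp) (close_of_mem_pair (hFlab c hcF) (hFlab p hp))
    rw [nonempty_iff_ne_empty] at hcp
    apply hcp
    have hpe' : c \ p = c := (show c \ p = e ∩ c from hpe).trans hce
    rw [inter_eq_sdiff_sdiff, hpe', Finset.sdiff_self]
  have hcov : ∀ e ∈ F \\ F, (∀ i, i ∈ U → i ∉ e → i ∈ c) → False := by
    intro e he h
    obtain ⟨p, hp, hpe⟩ := mem_image.mp (hsplit e he).2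
    have heU : e ⊆ U := by
      obtain ⟨f, hf, g, _, rfl⟩ := Finset.mem_diffs.mp he; exact sdiff_subset.trans (hU f (hFD f hf))
    exact hncov p hp (union_eq_of_sdiff_eq_compl_sdiff (hU p (hFD p hp)) hcU
      ((show p \ c = e \ c from hpe).trans (sdiff_eq_compl_sdiff_of heU h)))
  -- `c \ q ∉ co ΔF`
  have L4 : c \ q ∉ (F \\ F).image (fun z => U \ z) := by
    intro h
    obtain ⟨e, he, hee⟩ := mem_image.mp h
    refine hcov e he fun i hiU hie => ?_
    have : i ∈ U \ e := mem_sdiff.mpr ⟨hiU, hie⟩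
    rw [hee, mem_sdiff] at this
    exact this.1
  have L5 : q \ c ∈ F \\ F → c ∪ q ∈ F := fun h => by
    have h2' := (hsplit _ h).2
    rw [sdiff_sdiff_same] at h2'
    have h3 := htp _ h0E₁ _ h2'
    rwa [sdiff_empty_union_sdiff] at h3
  have L6 : c \ q ∈ F \\ F → c ∩ q ∈ F := fun h => by
    have h1' := (hsplit _ h).1
    rw [sdiff_inter_same] at h1'
    have h3 := htp _ h1' _ h0E₂
    rwa [sdiff_sdiff_union_empty] at h3
  have hsame : ∀ {s s' : Finset α}, s ∈ 𝒟 → s' ∈ 𝒟 → s ∉ symGen U 𝒟 x → s' ∉ symGen U 𝒟 x → x s = x s' → s \ s' ∉ 𝒟 :=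
    fun hs hs' hd hd' hl => (sdiff_notMem_of_dead_of_label_eq hU hco hanti hs hs' hd hd' hl).2
  have hcl_of_mem : c \ q ∈ 𝒟 ∨ q \ c ∈ 𝒟 → x c = ℓ := by
    intro h
    rcases hFlab c hcF with h0 | h1'
    · exact h0
    · exfalso
      rcases h with h | h
      · exact hsame hcD hqD (hFdead c hcF) hqdead (by rw [h1', hqlab]) h
      · exact hsame hqD hcD hqdead (hFdead c hcF) (by rw [h1', hqlab]) h
  by_cases A1 : q \ c ∉ 𝒟 ∧ q \ c ∉ F \\ F
  · exact Or.inl ⟨A1.1, A1.2, L3⟩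
  by_cases A2 : c \ q ∉ 𝒟 ∧ c \ q ∉ F \\ F
  · exact Or.inr (Or.inl ⟨A2.1, A2.2, L4⟩)
  rw [not_and_or, not_not, not_not] at A1 A2
  rcases A1 with hγ' | hqc
  · have hcl : x c = ℓ := hcl_of_mem (Or.inr hγ')
    have hlab : x q = x c + 1 := by rw [hqlab, hcl]
    rcases A2 with hγ | hcq
    · -- both blockers
      have habs : c ∩ q ∉ 𝒟 := inter_notMem_of_both_sdiff_mem hU hco hanti hc hq hlab hγ hγ'
      refine Or.inr (Or.inr ⟨hγ', hγ, habs, ?_, ?_⟩)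
      · intro h
        obtain ⟨p, hp, hpe⟩ := mem_image.mp (hsplit _ h).1
        have hmem : c ∩ p ∈ F := by
          have h3 := htp _ (mem_image_of_mem _ hp) _ h0E₂
          rwa [sdiff_sdiff_union_empty] at h3
        have e3 : c ∩ p = c \ q := by
          rw [inter_eq_sdiff_sdiff]; exact sdiff_sdiff_inter_inter c p q hpe
        rw [e3] at hmem
        exact hFdead _ hmem (sdiff_mem_symGen_of_adjacent hU hco hanti hcD hqD hlab)
      · intro h
        obtain ⟨e, he, hee⟩ := mem_image.mp h
        refine hcov e he fun i hiU hie => ?_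
        have : i ∈ U \ e := mem_sdiff.mpr ⟨hiU, hie⟩
        rw [hee, mem_inter] at this
        exact this.1
    · exfalso
      have hm : c ∩ q ∈ F := L6 hcq
      rcases hFlab _ hm with hm0 | hm1
      · have hl := label_sdiff_of_dead_adjacent' hU hco hanti hc hq hlab hγ'
        have hfar2 : ¬ Close (x (c ∩ q)) (x (q \ c)) := by rw [hm0, hl, hcl]; exact notClose_add_two ℓ
        have h := union_mem_symGen_of_not_close hU hco hanti (hFD _ hm) hγ' hfar2
        rw [inter_union_sdiff_eq] at h
        exact hqdead h
      · have h := hsame hqD (hFD _ hm) hqdead (hFdead _ hm) (by rw [hqlab, hm1])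
        rw [sdiff_inter_eq_sdiff] at h
        exact h hγ'
  · rcases A2 with hγ | hcq
    · exfalso
      have hcl : x c = ℓ := hcl_of_mem (Or.inl hγ)
      have hlab : x q = x c + 1 := by rw [hqlab, hcl]
      have hm : c ∪ q ∈ F := L5 hqc
      rcases hFlab _ hm with hm0 | hm1
      · have hl := label_sdiff_of_dead_adjacent hU hco hanti hc hq hlab hγ
        have hfar2 : ¬ Close (x (c ∪ q)) (x (U \ (c \ q))) := by
          rw [hm0, hanti _ hγ, hl, hcl, add_five_add_three_eq]; exact notClose_add_two ℓ
        have h := farProducts_subset_symGen hU hco hanti (hFD _ hm)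
          (mem_farProducts.mpr ⟨U \ (c \ q), hco _ hγ, hfar2, Or.inl (eq_union_inter_compl_sdiff hqU hcU)⟩)
        exact hqdead h
      · have h := hsame (hFD _ hm) hqD (hFdead _ hm) hqdead (by rw [hm1, hqlab])
        rw [union_sdiff_eq_sdiff] at h
        exact h hγ
    · exfalso
      apply hqF
      have h2' := (hsplit _ hqc).2
      rw [sdiff_sdiff_same] at h2'
      have h1' := (hsplit _ hcq).1
      rw [sdiff_inter_same] at h1'
      have h3 := htp _ h1' _ h2'
      rwa [sdiff_sdiff_union_sdiff] at h3

/-- The four far-product identities placing the three shapes among candidates: for dead `c` (label `ℓ` or `ℓ+1`) and dead `q` (label `ℓ+1`):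
`q \ c ∈ C(q) ∩ C(U \ c)` and `c \ q ∈ C(c) ∩ C(U \ q)` whenever absent. -/
theorem sdiff_mem_candidates_four (hU : ∀ a ∈ 𝒟, a ⊆ U) (hco : ∀ a ∈ 𝒟, U \ a ∈ 𝒟)
    (hanti : ∀ a ∈ 𝒟, x (U \ a) = x a + 3) {ℓ : ZMod 6} {c q : Finset α} (hcD : c ∈ 𝒟) (hqD : q ∈ 𝒟)
    (hcl : x c = ℓ ∨ x c = ℓ + 1) (hqlab : x q = ℓ + 1) :
    (q \ c ∉ 𝒟 → q \ c ∈ candidates 𝒟 x q ∧ q \ c ∈ candidates 𝒟 x (U \ c)) ∧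
    (c \ q ∉ 𝒟 → c \ q ∈ candidates 𝒟 x c ∧ c \ q ∈ candidates 𝒟 x (U \ q)) := by
  have hcU : c ⊆ U := hU c hcD
  have hqU : q ⊆ U := hU q hqD
  have hcc : ∀ a : Finset α, a ⊆ U → U \ (U \ a) = a := fun a ha => Finset.sdiff_sdiff_eq_self ha
  have hfar1 : ¬ Close (x q) (x (U \ c)) := by rw [hanti c hcD, hqlab]; exact notClose_add_one_add_three_of_pair hcl
  have hfar2 : ¬ Close (x c) (x (U \ q)) := by rw [hanti q hqD, hqlab]; exact notClose_add_one_add_three_of_pair' hcl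
  have e1 : q \ c = q ∩ (U \ c) := by
    have h := sdiff_univ_compl_eq_inter (U := U) (f := U \ c) hqU; rwa [hcc c hcU] at h
  have e2 : c \ q = c ∩ (U \ q) := by
    have h := sdiff_univ_compl_eq_inter (U := U) (f := U \ q) hcU; rwa [hcc q hqU] at h
  have e1' : q \ c = (U \ c) ∩ q := by rw [e1, inter_comm]
  have e2' : c \ q = (U \ q) ∩ c := by rw [e2, inter_comm]
  unfold candidates
  constructor
  · intro h
    exact ⟨mem_sdiff.mpr ⟨mem_farProducts.mpr ⟨U \ c, hco c hcD, hfar1, Or.inl e1⟩, h⟩,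
      mem_sdiff.mpr ⟨mem_farProducts.mpr ⟨q, hqD, by rw [close_comm]; exact hfar1, Or.inl e1'⟩, h⟩⟩
  · intro h
    exact ⟨mem_sdiff.mpr ⟨mem_farProducts.mpr ⟨U \ q, hco q hqD, hfar2, Or.inl e2⟩, h⟩,
      mem_sdiff.mpr ⟨mem_farProducts.mpr ⟨c, hcD, by rw [close_comm]; exact hfar2, Or.inl e2'⟩, h⟩⟩

/-- **The new candidate inside `N(cl F)`**: with the data of `candidate_shape_of_tight`, `U \ c` or `c` has a candidate outside `ΔF ∪ co ΔF`. -/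
theorem exists_candidate_notMem_cl_diffs' (hU : ∀ a ∈ 𝒟, a ⊆ U) (hco : ∀ a ∈ 𝒟, U \ a ∈ 𝒟)
    (hanti : ∀ a ∈ 𝒟, x (U \ a) = x a + 3) {F : Finset (Finset α)} (hF : F ⊆ dead U 𝒟 x) {ℓ : ZMod 6}
    (hFlab : ∀ f ∈ F, x f = ℓ ∨ x f = ℓ + 1) {q : Finset α} (hq : q ∈ dead U 𝒟 x) (hqlab : x q = ℓ + 1) (hqF : q ∉ F)
    {c : Finset α} (hcF : c ∈ F)
    (htp : ∀ e₁ ∈ F.image (c \ ·), ∀ e₂ ∈ F.image (· \ c), (c \ e₁) ∪ e₂ ∈ F)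
    (hsplit : ∀ e ∈ F \\ F, e ∩ c ∈ F.image (c \ ·) ∧ e \ c ∈ F.image (· \ c)) :
    ∃ w : Finset α, (w ∈ candidates 𝒟 x (U \ c) ∨ w ∈ candidates 𝒟 x c) ∧ w ∉ F \\ F ∧ w ∉ (F \\ F).image (fun z => U \ z) := by
  have hcD : c ∈ 𝒟 := (mem_filter.mp (hF hcF)).1
  have hqD : q ∈ 𝒟 := (mem_filter.mp hq).1
  obtain ⟨h1, h2⟩ := sdiff_mem_candidates_four hU hco hanti hcD hqD (hFlab c hcF) hqlab
  rcases candidate_shape_of_tight hU hco hanti hF hFlab hq hqlab hqF hcF htp hsplit with ⟨ha, hb, hc⟩ | ⟨ha, hb, hc⟩ | ⟨hγ', hγ, habs, hb, hc⟩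
  · exact ⟨q \ c, Or.inl (h1 ha).2, hb, hc⟩
  · exact ⟨c \ q, Or.inr (h2 ha).1, hb, hc⟩
  · have hlab : x q = x c + 1 := by
      rcases hFlab c hcF with h0 | h1'
      · rw [hqlab, h0]
      · exfalso
        exact (sdiff_notMem_of_dead_of_label_eq hU hco hanti hcD hqD (mem_filter.mp (hF hcF)).2 (mem_filter.mp hq).2
          (by rw [h1', hqlab])).2 hγ
    exact ⟨c ∩ q, Or.inr (inter_mem_candidates_of_sdiff_mem hU hco hanti (hF hcF) hq hlab hγ habs), hb, hc⟩

/-- **The new candidate inside `N(cl H)` for any family `H ∋ q`**: with the same data, `q` or `U \ q` has a candidate outside `ΔF ∪ co ΔF`. -/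
theorem exists_candidate_notMem_cl_diffs'' (hU : ∀ a ∈ 𝒟, a ⊆ U) (hco : ∀ a ∈ 𝒟, U \ a ∈ 𝒟)
    (hanti : ∀ a ∈ 𝒟, x (U \ a) = x a + 3) {F : Finset (Finset α)} (hF : F ⊆ dead U 𝒟 x) {ℓ : ZMod 6}
    (hFlab : ∀ f ∈ F, x f = ℓ ∨ x f = ℓ + 1) {q : Finset α} (hq : q ∈ dead U 𝒟 x) (hqlab : x q = ℓ + 1) (hqF : q ∉ F)
    {c : Finset α} (hcF : c ∈ F)
    (htp : ∀ e₁ ∈ F.image (c \ ·), ∀ e₂ ∈ F.image (· \ c), (c \ e₁) ∪ e₂ ∈ F)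
    (hsplit : ∀ e ∈ F \\ F, e ∩ c ∈ F.image (c \ ·) ∧ e \ c ∈ F.image (· \ c)) :
    ∃ w : Finset α, (w ∈ candidates 𝒟 x q ∨ w ∈ candidates 𝒟 x (U \ q)) ∧ w ∉ F \\ F ∧ w ∉ (F \\ F).image (fun z => U \ z) := by
  have hcD : c ∈ 𝒟 := (mem_filter.mp (hF hcF)).1
  have hqD : q ∈ 𝒟 := (mem_filter.mp hq).1
  obtain ⟨h1, h2⟩ := sdiff_mem_candidates_four hU hco hanti hcD hqD (hFlab c hcF) hqlab
  rcases candidate_shape_of_tight hU hco hanti hF hFlab hq hqlab hqF hcF htp hsplit with ⟨ha, hb, hc⟩ | ⟨ha, hb, hc⟩ | ⟨hγ', hγ, habs, hb, hc⟩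
  · exact ⟨q \ c, Or.inl (h1 ha).1, hb, hc⟩
  · exact ⟨c \ q, Or.inr (h2 ha).2, hb, hc⟩
  · have hlab : x q = x c + 1 := by
      rcases hFlab c hcF with h0 | h1'
      · rw [hqlab, h0]
      · exfalso
        exact (sdiff_notMem_of_dead_of_label_eq hU hco hanti hcD hqD (mem_filter.mp (hF hcF)).2 (mem_filter.mp hq).2
          (by rw [h1', hqlab])).2 hγ
    exact ⟨c ∩ q, Or.inl (inter_mem_candidates_of_sdiff_mem' hU hco hanti (hF hcF) hq hlab hγ' habs), hb, hc⟩

/-- **A non-full MS-tight two-class dead family has Hall slack ≥ 2.**  If `F ≠ ∅` is MS-tight, two-class (labels in `{ℓ, ℓ+1}`), and some dead `q ∉ F`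
has `x q = ℓ + 1`, then `2 #F + 2 ≤ #N(cl F)` — the new candidates live in `N(cl F)` itself (partners range over all of `𝒟`). -/
theorem two_mul_card_add_two_le_card_biUnion_candidates_of_tight_of_extra (hU : ∀ a ∈ 𝒟, a ⊆ U) (hco : ∀ a ∈ 𝒟, U \ a ∈ 𝒟)
    (hanti : ∀ a ∈ 𝒟, x (U \ a) = x a + 3) {F : Finset (Finset α)} (hF : F ⊆ dead U 𝒟 x) {ℓ : ZMod 6}
    (hlab : ∀ f ∈ F, x f = ℓ ∨ x f = ℓ + 1) (ht : #(F \\ F) = #F) (hFne : F.Nonempty) {q : Finset α} (hq : q ∈ dead U 𝒟 x)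
    (hqlab : x q = ℓ + 1) (hqF : q ∉ F) :
    2 * #F + 2 ≤ #((F ∪ F.image fun f => U \ f).biUnion (candidates 𝒟 x)) := by
  classical
  have hFD : ∀ f ∈ F, f ∈ 𝒟 := fun f hf => (mem_filter.mp (hF hf)).1
  have hFU : ∀ f ∈ F, f ⊆ U := fun f hf => hU f (hFD f hf)
  have hcc : ∀ a : Finset α, a ⊆ U → U \ (U \ a) = a := fun a ha => Finset.sdiff_sdiff_eq_self ha
  set A := F ∪ F.image fun f => U \ f with hA
  set N := A.biUnion (candidates 𝒟 x) with hN
  set X := (F \\ F) ∪ (F \\ F).image (fun z => U \ z) with hX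
  have hXN : X ⊆ N := cl_diffs_subset_biUnion_candidates_of_tight hU hco hanti hF hlab ht
  have hint : ∀ f ∈ F, ∀ g ∈ F, (f ∩ g).Nonempty := fun f hf g hg =>
    inter_nonempty_of_dead_of_close (hF hf) (hFD g hg) (close_of_mem_pair (hlab f hf) (hlab g hg))
  have hXcard : #X = 2 * #(F \\ F) := card_cl_diffs_eq_two_mul hFU hint
  obtain ⟨c, hcF, hpiv⟩ := TwistedAD.exists_pivot_of_card_diffs_eq_card F ht hFne
  have htp := tp_mem_of_pivot ht.le hpiv
  have hsplit : ∀ e ∈ F \\ F, e ∩ c ∈ F.image (c \ ·) ∧ e \ c ∈ F.image (· \ c) :=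
    fun e he => mem_diffs_pivot_split ht.le hpiv he
  obtain ⟨w, hw, hw1, hw2⟩ := exists_candidate_notMem_cl_diffs' hU hco hanti hF hlab hq hqlab hqF hcF htp hsplit
  have hcD : c ∈ 𝒟 := hFD c hcF
  have hcA : c ∈ A := mem_union_left _ hcF
  have hccA : U \ c ∈ A := mem_union_right _ (mem_image_of_mem _ hcF)
  have hwN : w ∈ N ∧ U \ w ∈ N ∧ w ⊆ U := by
    rcases hw with hw | hw
    · refine ⟨mem_biUnion.mpr ⟨U \ c, hccA, hw⟩, mem_biUnion.mpr ⟨c, hcA, ?_⟩, candidates_subset_ground hU (hco c hcD) hw⟩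
      have h := candidates_compl hU hco hanti (hco c hcD)
      rw [hcc c (hU c hcD)] at h
      rw [h]; exact mem_image_of_mem _ hw
    · refine ⟨mem_biUnion.mpr ⟨c, hcA, hw⟩, mem_biUnion.mpr ⟨U \ c, hccA, ?_⟩, candidates_subset_ground hU hcD hw⟩
      rw [candidates_compl hU hco hanti hcD]; exact mem_image_of_mem _ hw
  obtain ⟨hwN1, hwN2, hwU⟩ := hwN
  have hXU : ∀ e ∈ F \\ F, e ⊆ U := by
    intro e he; obtain ⟨f, hf, g, _, rfl⟩ := Finset.mem_diffs.mp he; exact sdiff_subset.trans (hFU f hf)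
  have hcw : U \ w ∉ X := by
    intro h
    rw [hX, mem_union, mem_image] at h
    rcases h with h | ⟨e, he, hee⟩
    · exact hw2 (mem_image.mpr ⟨U \ w, h, hcc w hwU⟩)
    · apply hw1
      have : e = w := by
        have h1 := congrArg (fun t => U \ t) hee
        simp only [hcc e (hXU e he), hcc w hwU] at h1
        exact h1
      rw [← this]; exact he
  have hwX : w ∉ X := fun h => by rw [hX, mem_union] at h; exact h.elim hw1 hw2
  have h1 := card_add_two_le_card_of_pair hXN hwN1 hwN2 hwX hcw (ne_compl_of_dead hU hq w)
  rw [hXcard, ht] at h1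
  exact h1

/-- The same for a missing dead member of the LOWER label (`x q = ℓ`), by the reflection `x ↦ -x`. -/
theorem two_mul_card_add_two_le_card_biUnion_candidates_of_tight_of_extra' (hU : ∀ a ∈ 𝒟, a ⊆ U) (hco : ∀ a ∈ 𝒟, U \ a ∈ 𝒟)
    (hanti : ∀ a ∈ 𝒟, x (U \ a) = x a + 3) {F : Finset (Finset α)} (hF : F ⊆ dead U 𝒟 x) {ℓ : ZMod 6}
    (hlab : ∀ f ∈ F, x f = ℓ ∨ x f = ℓ + 1) (ht : #(F \\ F) = #F) (hFne : F.Nonempty) {p : Finset α} (hp : p ∈ dead U 𝒟 x)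
    (hplab : x p = ℓ) (hpF : p ∉ F) :
    2 * #F + 2 ≤ #((F ∪ F.image fun f => U \ f).biUnion (candidates 𝒟 x)) := by
  have hanti' : ∀ a ∈ 𝒟, (fun s => -x s) (U \ a) = (fun s => -x s) a + 3 := by
    intro a ha; show -x (U \ a) = -x a + 3; rw [hanti a ha]; exact neg_add_three (x a)
  have h := two_mul_card_add_two_le_card_biUnion_candidates_of_tight_of_extra (x := fun s => -x s) hU hco hanti' (ℓ := -ℓ - 1)
    (F := F) (by rw [dead_neg]; exact hF) (fun f hf => by
      rcases hlab f hf with h | h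
      · right; simp only [h]; ring
      · left; simp only [h]; ring) ht hFne (q := p) (by rw [dead_neg]; exact hp) (by simp only [hplab]; ring) hpF
  rwa [candidates_neg] at h

/-- **Reduction of two-class (MATCH) to 'non-full ⟹ slack ≥ 2'.**  Suppose that every NONEMPTY two-class dead family `G` (labels in `{ℓ, ℓ+1}`)
which misses some dead member of these two classes has `#cl G + 2 ≤ #N(cl G)`.  Then Hall's condition `#cl F ≤ #N(cl F)` holds for every two-class
dead family `F`.  (For MS-tight `G` the hypothesis is the preceding theorem; the census of gen 70 found no exception — see the memo.) -/
theorem card_cl_le_card_biUnion_candidates_of_nonFull (hU : ∀ a ∈ 𝒟, a ⊆ U) (hco : ∀ a ∈ 𝒟, U \ a ∈ 𝒟)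
    (hanti : ∀ a ∈ 𝒟, x (U \ a) = x a + 3) (ℓ : ZMod 6)
    (hNF : ∀ G : Finset (Finset α), G ⊆ dead U 𝒟 x → (∀ g ∈ G, x g = ℓ ∨ x g = ℓ + 1) → G.Nonempty →
      (∃ s ∈ dead U 𝒟 x, (x s = ℓ ∨ x s = ℓ + 1) ∧ s ∉ G) →
      #(G ∪ G.image fun f => U \ f) + 2 ≤ #((G ∪ G.image fun f => U \ f).biUnion (candidates 𝒟 x)))
    {F : Finset (Finset α)} (hF : F ⊆ dead U 𝒟 x) (hlab : ∀ f ∈ F, x f = ℓ ∨ x f = ℓ + 1) :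
    #(F ∪ F.image fun f => U \ f) ≤ #((F ∪ F.image fun f => U \ f).biUnion (candidates 𝒟 x)) := by
  classical
  rcases F.eq_empty_or_nonempty with rfl | ⟨g, hg⟩
  · simp
  by_cases hfull : ∃ s ∈ dead U 𝒟 x, (x s = ℓ ∨ x s = ℓ + 1) ∧ s ∉ F
  · have h := hNF F hF hlab ⟨g, hg⟩ hfull; omega
  -- `F` is full: remove one member and use the hypothesis for `F.erase g` (or the singleton case)
  have hgdead : g ∈ dead U 𝒟 x := hF hg
  have hgD : g ∈ 𝒟 := (mem_filter.mp hgdead).1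
  have hgU : g ⊆ U := hU g hgD
  set G := F.erase g with hG
  have hGF : G ⊆ F := erase_subset g F
  have hmono : (G ∪ G.image fun f => U \ f) ⊆ (F ∪ F.image fun f => U \ f) :=
    union_subset_union hGF (image_subset_image hGF)
  have h1 := card_le_card (biUnion_subset_biUnion_of_subset_left (candidates 𝒟 x) hmono)
  have h2 : #(F ∪ F.image fun f => U \ f) ≤ #(G ∪ G.image fun f => U \ f) + 2 := by
    have hsub : (F ∪ F.image fun f => U \ f) ⊆ (G ∪ G.image fun f => U \ f) ∪ {g, U \ g} := by
      intro w hw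
      rw [mem_union, mem_insert, mem_singleton]
      rcases mem_union.mp hw with h | h
      · by_cases hws : w = g
        · exact Or.inr (Or.inl hws)
        · exact Or.inl (mem_union_left _ (mem_erase.mpr ⟨hws, h⟩))
      · obtain ⟨f, hf, rfl⟩ := mem_image.mp h
        by_cases hfs : f = g
        · exact Or.inr (Or.inr (by rw [hfs]))
        · exact Or.inl (mem_union_right _ (mem_image_of_mem _ (mem_erase.mpr ⟨hfs, hf⟩)))
    have h3 := (card_le_card hsub).trans (card_union_le _ _)
    have h4 : #({g, U \ g} : Finset (Finset α)) ≤ 2 := card_insert_le _ _ |>.trans (by rw [card_singleton])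
    omega
  rcases G.eq_empty_or_nonempty with hG0 | hGne
  · -- `F = {g}`: the candidates `∅`, `U` of `g`
    have h0 : (∅ : Finset α) ∉ 𝒟 := empty_notMem_of_dead hU hco hanti hgdead
    have hUn : U ∉ 𝒟 := fun h => h0 (by have := hco U h; rwa [Finset.sdiff_self] at this)
    have kfar : ∀ s : ZMod 6, ¬ Close s (s + 3) := by decide
    have hfar : ¬ Close (x g) (x (U \ g)) := by rw [hanti g hgD]; exact kfar _
    have hgA : g ∈ F ∪ F.image (fun f => U \ f) := mem_union_left _ hg
    have e1 : ∅ ∈ (F ∪ F.image fun f => U \ f).biUnion (candidates 𝒟 x) := mem_biUnion.mpr ⟨g, hgA, by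
      unfold candidates
      exact mem_sdiff.mpr ⟨mem_farProducts.mpr ⟨U \ g, hco g hgD, hfar, Or.inl (inter_sdiff_self g U).symm⟩, h0⟩⟩
    have e2 : U \ ∅ ∈ (F ∪ F.image fun f => U \ f).biUnion (candidates 𝒟 x) := mem_biUnion.mpr ⟨g, hgA, by
      rw [sdiff_empty]; unfold candidates
      exact mem_sdiff.mpr ⟨mem_farProducts.mpr ⟨U \ g, hco g hgD, hfar, Or.inr (by rw [union_sdiff_of_subset hgU])⟩, hUn⟩⟩
    have h := card_add_two_le_card_of_pair (empty_subset _) e1 e2 (notMem_empty _) (notMem_empty _) (ne_compl_of_dead hU hgdead ∅)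
    rw [hG0] at h2; simp only [image_empty, union_empty, card_empty] at h2 h
    omega
  · have hGdead : G ⊆ dead U 𝒟 x := fun f hf => hF (hGF hf)
    have hGlab : ∀ f ∈ G, x f = ℓ ∨ x f = ℓ + 1 := fun f hf => hlab f (hGF hf)
    have h := hNF G hGdead hGlab hGne ⟨g, hgdead, hlab g hg, notMem_erase g F⟩
    omega

end NonFull

end GeneratedDonors

end Summit.CriticalPhenomena.PercolationContinuityZ3.Theorems
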